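import Mathlib
import HarnessLib
import Literature.AlgebraicGeometry.Ramification.InertiaNormalSylow
import Summits.ResolutionOfSingularities.ResolutionOfSingularities.Theorems.WildQuotientsWildQuotientResolutionToralEndState
import Summits.ResolutionOfSingularities.ResolutionOfSingularities.Theorems.WildQuotientsWildQuotientResolutionKSBlowupLocalChart
import Summits.ResolutionOfSingularities.ResolutionOfSingularities.Theorems.WildQuotientsWildQuotientResolutionKSBlowupEquivariantChart

/-!
# Kollár–Szabó going down, blow-up step (K2-scheme): the point blow-up at a closed regular point fixed by an
# abelian group has a fixed closed point with inertia for the lifted action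
# (crux `WildQuotients.WildQuotientResolution`, stub `stub_phaseZeroHighDim`)

Crux stmt-ResolutionOfSingularities-15640 (`WildQuotientResolution`), registered stub `stub_phaseZeroHighDim`;
programme PHASE0-KS-EIGENLINE, target `hstep` of ✓`KSGoingDown.kollarSzaboGoingDown_of_step` (the abstract
equivariant point blow-up step of Kollár–Szabó «going down», Reichstein–Youssin 2000, App., Prop. A.2). This
file ASSEMBLES the fixed point: ✓`PointBlowupStalkData.exists_stalkAction` (stalk action of the inertia),
✓`InertLocusStalk.stalkAction_residueTrivial`, ✓`KSGoingDown.exists_equivariant_quadraticTransform_of_action`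
(the `σ`-stable quadratic transform `R = S[𝔪/t]_𝔫` of `S = 𝒪_{X,x}` at the eigenline `[W]`, hands 8-g0/8-g1/8-g2)
and ✓`KSGoingDown.exists_fixedPoint_liftAction_of_localChart` (lift uniqueness on `Spec R → Bl_x X`):

* `preimage_singleton_eq_of_forall_mem_inertiaSubgroup` — a point in everybody's inertia is set-theoretically
  fixed (the stability hypothesis of ✓`IsBlowup.liftAction` for the reduced centre `{x}`);
* `exists_fixedPoint_liftAction` — **for an integral scheme `X`, an abelian group `G` acting with `G = I_x` at a
  closed point `x` whose local ring is regular, not a field, with algebraically closed residue field, and a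
  blowing up `π : X' → X` along the reduced closed point `{x}` with its LIFTED action: there is a point
  `x' ∈ X'` over `x` with `g ∈ I_{x'}` for every `g`**, together with its local chart — a quadratic transform
  `R ⊆ Frac 𝒪_{X,x}` of `𝒪_{X,x}` with `𝔪_x R = (t)`, the same residue field, and `φ : Spec R → X'` over
  `Spec R → X` sending the closed point to `x'` (the data from which the next file reads off that `x'` is closed
  and regular of dimension `dim 𝒪_{X,x}`).

[OURS · crux stmt-ResolutionOfSingularities-15640 · helper toward `stub_phaseZeroHighDim` (the fixed point of the
abstract blow-up step of Kollár–Szabó going down; NOT a proof of the stub); counted 0; AI-level work, weaker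
than expert review.] [cite: ReichsteinYoussin2000, Appendix (Kollár–Szabó), proof of Prop. A.2]
-/

-- single-problem summit: the doubled namespace component `ResolutionOfSingularities` is forced
set_option linter.dupNamespace false

noncomputable section

open CategoryTheory CategoryTheory.Limits AlgebraicGeometry TopologicalSpace IsLocalRing
open Literature.AlgebraicGeometry.Ramification Literature.AlgebraicGeometry.Resolution
open Scheme.IdealSheafData
open Summit.ResolutionOfSingularities.ResolutionOfSingularities.Theorems.WildQuotientResolution

namespace Summit.ResolutionOfSingularities.ResolutionOfSingularities.Theorems.WildQuotientResolution.KSGoingDown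

/-- A point lying in the inertia group of every element is set-theoretically fixed: `σ_g⁻¹ {x} = {x}` (the
stability hypothesis of ✓`IsBlowup.liftAction` for the reduced centre `{x}`). [folklore] -/
theorem preimage_singleton_eq_of_forall_mem_inertiaSubgroup {X : Scheme.{0}} {G : Type} [Group G]
    (σ : G →* Aut X) {x : X} (hGx : ∀ g, g ∈ inertiaSubgroup σ x) (g : G) :
    (σ g).hom.base ⁻¹' ({x} : Set X) = {x} := by
  have hfix : ∀ g, (σ g).hom.base x = x := fun g => apply_eq_of_mem_inertiaSubgroup σ (hGx g)
  ext z
  simp only [Set.mem_preimage, Set.mem_singleton_iff]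
  constructor
  · intro hz
    have h1 : (σ g⁻¹).hom.base ((σ g).hom.base z) = z := by
      rw [← Scheme.Hom.comp_apply, ← Iso.trans_hom, ← Aut.Aut_mul_def, ← map_mul, inv_mul_cancel, map_one]
      rfl
    rw [← h1, hz, hfix]
  · rintro rfl
    exact hfix g

/-- **The fixed point of the point blow-up (Kollár–Szabó going down, step (K2)).** Let `X` be an integral scheme,
`G` an abelian group acting on `X` with `g ∈ I_x` for all `g` at a closed point `x` whose local ring is regular,
not a field, with algebraically closed residue field, and `π : X' → X` a blowing up along the reduced closed point
`{x}`, with the lifted action (✓`IsBlowup.liftAction`). Then there are a local subring `R ⊆ Frac 𝒪_{X,x}` — a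
quadratic transform of `𝒪_{X,x}` with an injective local structure map `ι`, `𝔪_x R = (t)` for some `t ≠ 0`, and
the same residue field — a morphism `φ : Spec R → X'` over `Spec R → Spec 𝒪_{X,x} → X`, and the point
`x' = φ(closed point) ∈ X'` over `x`, such that every `g` lies in the inertia group of the lifted action at `x'`.
[cite: ReichsteinYoussin2000, Appendix (Kollár–Szabó), proof of Prop. A.2] -/
theorem exists_fixedPoint_liftAction {X : Scheme.{0}} [IsIntegral X] {G : Type} [CommGroup G]
    (σ : G →* Aut X) {x : X} (hx : IsClosed ({x} : Set X)) (hGx : ∀ g, g ∈ inertiaSubgroup σ x)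
    [IsRegularLocalRing (X.presheaf.stalk x)] [IsAlgClosed (ResidueField (X.presheaf.stalk x))]
    (hnf : ¬ IsField (X.presheaf.stalk x))
    {X' : Scheme.{0}} {π : X' ⟶ X} (hπ : IsBlowup π (vanishingIdeal ⟨{x}, hx⟩)) :
    ∃ (R : Subring (FractionRing (X.presheaf.stalk x))) (_ : IsLocalRing R)
      (ι : X.presheaf.stalk x →+* R) (_ : IsLocalHom ι) (t : R) (φ : Spec (.of R) ⟶ X') (x' : X'),
      IsQuadraticTransform (algebraMap (X.presheaf.stalk x) (FractionRing (X.presheaf.stalk x))).range R ∧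
      (∀ a, ((ι a : R) : FractionRing (X.presheaf.stalk x)) =
        algebraMap (X.presheaf.stalk x) (FractionRing (X.presheaf.stalk x)) a) ∧
      Function.Injective ι ∧ t ≠ 0 ∧ (maximalIdeal (X.presheaf.stalk x)).map ι = Ideal.span {t} ∧
      (∀ r : R, ∃ a, ι a - r ∈ maximalIdeal R) ∧
      φ ≫ π = Spec.map (CommRingCat.ofHom ι) ≫ X.fromSpecStalk x ∧ φ (closedPoint R) = x' ∧ π x' = x ∧
      ∀ g, g ∈ inertiaSubgroup (hπ.liftAction σ (vanishingIdeal_comap_eq_of_action σ ⟨{x}, hx⟩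
        (preimage_singleton_eq_of_forall_mem_inertiaSubgroup σ hGx))) x' := by
  -- the stalk action of `G = I_x` and its residue-triviality
  obtain ⟨a, τ, hkey, hτ⟩ := PointBlowupStalkData.exists_stalkAction σ x (⊤ : Subgroup G)
    (fun g _ => apply_eq_of_mem_inertiaSubgroup σ (hGx g))
  have htop : (⊤ : Subgroup G) ≤ inertiaSubgroup σ x := fun g _ => hGx g
  have hresO : ∀ (g : (⊤ : Subgroup G)) (s : X.presheaf.stalk x), τ g s - s ∈ maximalIdeal _ :=
    InertLocusStalk.stalkAction_residueTrivial σ x a τ hkey hτ htop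
  -- the equivariant quadratic transform (hands 8-g0/8-g1/8-g2)
  obtain ⟨R, hRloc, ι, hιloc, t, α, hQT, hι, hιinj, ht0, hmap, hα, hres, hcong⟩ :=
    exists_equivariant_quadraticTransform_of_action hnf τ hresO
  -- repackage over `G`
  let a' : G → (X.presheaf.stalk x ⟶ X.presheaf.stalk x) := fun g => a ⟨g, Subgroup.mem_top g⟩
  have hkey' : ∀ g, Spec.map (a' g) ≫ X.fromSpecStalk x = X.fromSpecStalk x ≫ (σ g).hom := fun g =>
    hkey ⟨g, Subgroup.mem_top g⟩
  let α' : G → (R →+* R) := fun g => α ⟨g⁻¹, Subgroup.mem_top _⟩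
  have hα' : ∀ g, (α' g).comp ι = ι.comp (a' g).hom := by
    intro g
    have hinv : (⟨g⁻¹, Subgroup.mem_top _⟩ : (⊤ : Subgroup G))⁻¹ = ⟨g, Subgroup.mem_top g⟩ :=
      Subtype.ext (inv_inv g)
    refine (hα ⟨g⁻¹, Subgroup.mem_top _⟩).trans ?_
    ext s
    change ((ι (τ ⟨g⁻¹, Subgroup.mem_top _⟩ s) : R) : FractionRing (X.presheaf.stalk x)) =
      ((ι ((a ⟨g, Subgroup.mem_top g⟩).hom s) : R) : FractionRing (X.presheaf.stalk x))
    rw [hτ, hinv]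
  have hres' : ∀ (g : G) (r : R), α' g r - r ∈ maximalIdeal R := fun g r => hres _ r
  have htnz : t ∈ nonZeroDivisors R := mem_nonZeroDivisors_of_ne_zero ht0
  -- the local chart and its fixed closed point
  obtain ⟨φ, x', hφ, hφx', hx'x, hinert⟩ :=
    exists_fixedPoint_liftAction_of_localChart hx hπ σ
      (preimage_singleton_eq_of_forall_mem_inertiaSubgroup σ hGx) a' hkey' ι htnz hmap α' hα' hres'
  exact ⟨R, hRloc, ι, hιloc, t, φ, x', hQT, hι, hιinj, ht0, hmap, hcong, hφ, hφx', hx'x, hinert⟩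

end Summit.ResolutionOfSingularities.ResolutionOfSingularities.Theorems.WildQuotientResolution.KSGoingDown

end
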